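import Summits.AtomisticToContinuum.Crystallization.Theorems.ThreeConeCertificateSlackRigidityHcpUniq
import Summits.AtomisticToContinuum.Crystallization.Theorems.ThreeConeCertificateSlackRigidityUniqExclusion
import Summits.AtomisticToContinuum.Crystallization.Theorems.ThreeConeCertificateSlackRigidityUniqUniqueMax
import HarnessLib

/-!
# `stub_hcpOptimalCongruent` — uniqueness of the relaxed-hcp Lennard-Jones optimum up to congruence
(crux `SlackRigidity`, stmt-AtomisticToContinuum-11960, line `ekeland-surgery-parity`; the registered stub, closed)

Two box-minimisers of `(a,h) ↦ e(hcp(a,h))` on `[1/2,2]²` give congruent stackings: the landed analysis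
`EkelandSurgeryParityHcpUniq.hcpOptimalCongruent_of_numerics` fed with the two certified-numerics
statements `stub_hcpShapeExclusion` (shape exclusion outside `[7/10, 9/10]`) and `stub_hcpShapeUniqueMax`
(unique maximiser of `S₃²/S₆` on the window).  With this, the Palm reduction
`slackRigidity_of_palmRigidity_of_hcpOptimalCongruent` reduces the crux to item 9224 alone. [folklore]
-/

noncomputable section

namespace Summit.AtomisticToContinuum.Crystallization.Theorems.EkelandSurgeryParityUniqFinal

open Literature.MathematicalPhysics.StatisticalMechanics
open Summit.AtomisticToContinuum.Crystallization.Theorems.SlackRigidityNegative (E3)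
open Summit.AtomisticToContinuum.Crystallization.Theorems.EkelandSurgeryParityUniq
  (stub_hcpShapeExclusion stub_hcpShapeUniqueMax)

/-- **Registered stub `stub_hcpOptimalCongruent`** (crux stmt-AtomisticToContinuum-11960, line
`ekeland-surgery-parity`): box-minimisers of the relaxed-hcp Lennard-Jones energy per particle on
`[1/2, 2]²` are congruent (indeed equal). [folklore] -/
theorem stub_hcpOptimalCongruent :
    ∀ (a h a' h' : ℝ) (ha : a ≠ 0) (hh : h ≠ 0) (ha' : a' ≠ 0) (hh' : h' ≠ 0),
    1 / 2 ≤ a → a ≤ 2 → 1 / 2 ≤ h → h ≤ 2 → 1 / 2 ≤ a' → a' ≤ 2 → 1 / 2 ≤ h' → h' ≤ 2 →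
    (∀ (b k : ℝ) (hb : b ≠ 0) (hk : k ≠ 0), 1 / 2 ≤ b → b ≤ 2 → 1 / 2 ≤ k → k ≤ 2 →
      (hcpPeriodicConfiguration ha hh).energyPerParticle lennardJones ≤
        (hcpPeriodicConfiguration hb hk).energyPerParticle lennardJones) →
    (∀ (b k : ℝ) (hb : b ≠ 0) (hk : k ≠ 0), 1 / 2 ≤ b → b ≤ 2 → 1 / 2 ≤ k → k ≤ 2 →
      (hcpPeriodicConfiguration ha' hh').energyPerParticle lennardJones ≤
        (hcpPeriodicConfiguration hb hk).energyPerParticle lennardJones) →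
    ∃ B : E3 →ₗᵢ[ℝ] E3, hcpStacking a' h' = B '' hcpStacking a h :=
  EkelandSurgeryParityHcpUniq.hcpOptimalCongruent_of_numerics stub_hcpShapeExclusion stub_hcpShapeUniqueMax

end Summit.AtomisticToContinuum.Crystallization.Theorems.EkelandSurgeryParityUniqFinal

end
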